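import Mathlib
import Literature.Computability.AlgebraicComplexity.OrbitCoordinateRing
import Literature.Computability.AlgebraicComplexity.ChowHighestWeight
import Literature.NumberTheory.DiophantineGeometry.GLHighestWeight
import Literature.NumberTheory.DiophantineGeometry.TensorWordModel
import Literature.NumberTheory.DiophantineGeometry.SchurWeylPlethysm
import Literature.NumberTheory.DiophantineGeometry.SchurWeylPlethysmOrbitWeightsProofs

/-!
# The semigroup floor — explicit monomial proof
(crux `ValuativeGCT.ValuativeFlip`, stmt-ValiantsHypothesis-12624; stub `semigroupFloor`,
siege variation "explicit / elementary")

In the coordinate ring `ℂ[Δ_m(f)] = OrbitCoordRing f m` of the orbit closure of ANY form `f` of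
degree `m ≠ 0`, let `F₀, …, F_D` be algebraically independent highest-weight vectors of one
weight `χ`.  Then for every `k`

  `C(k + D, D) ≤ orbitMultiplicity ℂ f m (k • χ)`.

The proof is the explicit one: the `C(k + D, D)` monomials `∏ i, F i ^ e i` with `∑ i, e i = k`
(exponent vectors `e ∈ Finset.univ.finsuppAntidiag k`, counted by Mathlib's stars-and-bars
`Finset.card_finsuppAntidiag_nat_eq_choose`)
* are highest-weight vectors of weight `k • χ`, because `GL` acts on `ℂ[Δ_m(f)]` by algebra
  endomorphisms (`orbitCoordRep_apply`), so an upper triangular `g` multiplies `∏ F i ^ e i` by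
  `∏ χ(g) ^ e i = (k • χ)(g)` — proved for families of possibly DIFFERENT weights `χ i`, the
  monomial then having weight `∑ i, e i • χ i` (`prod_pow_mem_highestWeightSpace`, the semigroup
  property of highest weights in an algebra representation, with `weightChar_sum_nsmul`);
* are linearly independent, because they are the images of the distinct monomials `X ^ e` of
  `MvPolynomial (Fin (D + 1)) ℂ` under `MvPolynomial.aeval F`, which is injective by algebraic
  independence (`linearIndependent_prod_pow_of_algebraicIndependent`, any commutative algebra);
* and live in a finite-dimensional space (a weight pins the degree,
  `finiteDimensional_highestWeightSpace_orbitCoordRep_holds`), so they bound its `finrank` from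
  below.

This file is self-contained over the Literature layer (it uses neither the graded-filtration
lemma `stub_gradedFloor` nor `stub_hwvMul` of `Theorems/ValuativeGCTValuativeFlipSemigroupFloor.lean`,
whose `semigroupFloor` it re-proves by a different route); the auxiliary lemmas are stated for
arbitrary finite index types, weight families and exponent vectors so that they can serve other
multiplicity floors (mixed products of seeds of different weights).

Sources: Kaveh–Khovanskii, Ann. Math. 176 (2012) §1 (semigroups of graded algebras);
BLMW, SIAM J. Comput. 40 (2011) §5.2; Goodman–Wallach §3.1.3 (weight characters); folklore.
-/

-- `Summit.ValiantsHypothesis.ValiantsHypothesis.…` (summit = problem) trips the dupNamespace linter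
set_option linter.dupNamespace false

namespace Summit.ValiantsHypothesis.ValiantsHypothesis.Theorems.ValuativeFlip.SemigroupFloorElementary

open scoped BigOperators
open Literature.NumberTheory.DiophantineGeometry Literature.Computability.AlgebraicComplexity

noncomputable section

/-- **Weight characters turn sums of weights into products**: on an upper triangular `g` (whose
diagonal is nonzero), `(∑ i ∈ s, e i • χ i)(g) = ∏ i ∈ s, χ i (g) ^ e i`.
[Goodman–Wallach §3.1.3; folklore] -/
theorem weightChar_sum_nsmul {σ ι : Type*} [Fintype σ] [LinearOrder σ] (s : Finset ι)
    (χ : ι → Weight σ) (e : ι → ℕ) {g : GL σ ℂ} (hg : IsUpperTriangular g) :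
    weightChar (∑ i ∈ s, e i • χ i) g = ∏ i ∈ s, weightChar (χ i) g ^ e i := by
  classical
  induction s using Finset.induction_on with
  | empty =>
    rw [Finset.sum_empty, Finset.prod_empty, weightChar]
    exact Finset.prod_eq_one fun i _ => by rw [Pi.zero_apply, zpow_zero]
  | insert a s ha ih =>
    rw [Finset.sum_insert ha, Finset.prod_insert ha, weightChar_add _ _ hg, weightChar_nsmul _ _ hg,
      ih]

/-- **Monomials in highest-weight vectors are highest-weight vectors, weights adding** (the
semigroup property of highest weights in an algebra representation).  In the coordinate ring
`ℂ[Δ_m(f)]` of the orbit closure of a form `f`, on which `GL σ ℂ` acts by algebra endomorphisms,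
if `F i` is a highest-weight vector of weight `χ i` for every `i` in a finite index type, then for
every exponent vector `e` the monomial `∏ i, F i ^ e i` is a highest-weight vector of weight
`∑ i, e i • χ i`: an upper triangular `g` acts on it by `∏ i, χ i (g) ^ e i`.
[folklore; BLMW 2011 §5.2] -/
theorem prod_pow_mem_highestWeightSpace {σ : Type} [Fintype σ] [LinearOrder σ]
    (f : MvPolynomial σ ℂ) (m : ℕ) {ι : Type} [Fintype ι] (χ : ι → Weight σ)
    (F : ι → OrbitCoordRing f m) (hF : ∀ i, F i ∈ highestWeightSpace (orbitCoordRep f m) (χ i))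
    (e : ι → ℕ) :
    ∏ i, F i ^ e i ∈ highestWeightSpace (orbitCoordRep f m) (∑ i, e i • χ i) := by
  rw [mem_highestWeightSpace_iff]
  intro g hg
  have hc : ∀ i, orbitCoordRep f m g (F i) = weightChar (χ i) g • F i := fun i => hF i g hg
  rw [orbitCoordRep_apply, map_prod]
  simp_rw [map_pow, ← orbitCoordRep_apply, hc, smul_pow]
  rw [Finset.prod_smul, weightChar_sum_nsmul _ _ _ hg]

/-- The one-weight case: if every `F i` is a highest-weight vector of weight `χ`, the monomial
`∏ i, F i ^ e i` is a highest-weight vector of weight `(∑ i, e i) • χ`. [folklore; BLMW 2011 §5.2] -/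
theorem prod_pow_mem_highestWeightSpace_nsmul {σ : Type} [Fintype σ] [LinearOrder σ]
    (f : MvPolynomial σ ℂ) (m : ℕ) (χ : Weight σ) {ι : Type} [Fintype ι]
    (F : ι → OrbitCoordRing f m) (hF : ∀ i, F i ∈ highestWeightSpace (orbitCoordRep f m) χ)
    (e : ι → ℕ) :
    ∏ i, F i ^ e i ∈ highestWeightSpace (orbitCoordRep f m) ((∑ i, e i) • χ) := by
  have h := prod_pow_mem_highestWeightSpace f m (fun _ => χ) F hF e
  rwa [← Finset.sum_smul] at h

/-- **Algebraic independence makes monomials linearly independent.**  If `F : ι → A` is an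
algebraically independent family in a commutative `R`-algebra `A` (`ι` finite), then the monomials
`e ↦ ∏ i, F i ^ e i` (`e : ι →₀ ℕ`) are linearly independent over `R`: they are the images of the
monomial basis `X ^ e` of `MvPolynomial ι R` under the injective algebra map `MvPolynomial.aeval F`.
[folklore] -/
theorem linearIndependent_prod_pow_of_algebraicIndependent {R A ι : Type*} [CommRing R]
    [CommRing A] [Algebra R A] [Fintype ι] (F : ι → A) (hind : AlgebraicIndependent R F) :
    LinearIndependent R (fun e : ι →₀ ℕ => ∏ i, F i ^ e i) := by
  have h0 := (MvPolynomial.basisMonomials ι R).linearIndependent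
  rw [MvPolynomial.coe_basisMonomials] at h0
  have hker : LinearMap.ker (MvPolynomial.aeval F : MvPolynomial ι R →ₐ[R] A).toLinearMap = ⊥ :=
    LinearMap.ker_eq_bot_of_injective (by rw [AlgHom.coe_toLinearMap]; exact hind)
  have h1 := h0.map' _ hker
  rw [AlgHom.coe_toLinearMap] at h1
  have hfun : ((MvPolynomial.aeval F : MvPolynomial ι R →ₐ[R] A) ∘ fun s : ι →₀ ℕ =>
      MvPolynomial.monomial s (1 : R)) = fun e : ι →₀ ℕ => ∏ i, F i ^ e i := by
    funext e
    simp only [Function.comp_apply, MvPolynomial.aeval_monomial, map_one, one_mul]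
    rw [Finsupp.prod_fintype _ _ (fun i => pow_zero (F i))]
  rw [hfun] at h1
  exact h1

/-- The number of exponent vectors `e : Fin (D + 1) →₀ ℕ` of total degree `k` (monomials of degree
`k` in `D + 1` variables) is `C(k + D, D)` (stars and bars). [folklore] -/
theorem card_finsuppAntidiag_fin_succ (D k : ℕ) :
    ((Finset.univ : Finset (Fin (D + 1))).finsuppAntidiag k).card = (k + D).choose D := by
  classical
  rw [Finset.card_finsuppAntidiag_nat_eq_choose, Finset.card_univ, Fintype.card_fin,
    show D + 1 + k - 1 = k + D by omega, Nat.choose_symm_add]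

/-- **The semigroup floor** (stub `semigroupFloor` of crux `ValuativeGCT.ValuativeFlip`, explicit
monomial proof): in the coordinate ring of the orbit closure of ANY form `f` of degree `m ≠ 0`,
`D + 1` algebraically independent highest-weight vectors `F₀, …, F_D` of weight `χ` force
`orbitMultiplicity ℂ f m (k • χ) ≥ C(k + D, D)` for every `k`: the `C(k + D, D)` monomials
`∏ i, F i ^ e i` with `∑ e i = k` are linearly independent highest-weight vectors of weight `k • χ`
in the finite-dimensional highest-weight space (a weight pins the degree, `m ≠ 0`).
[Kaveh–Khovanskii 2012 §1; BLMW 2011 §5.2; folklore] -/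
theorem semigroupFloor {σ : Type} [Fintype σ] [LinearOrder σ] (f : MvPolynomial σ ℂ) {m : ℕ}
    (hm : m ≠ 0) (χ : Weight σ) (D : ℕ) (F : Fin (D + 1) → OrbitCoordRing f m)
    (hF : ∀ i, F i ∈ highestWeightSpace (orbitCoordRep f m) χ) (hind : AlgebraicIndependent ℂ F)
    (k : ℕ) : (k + D).choose D ≤ orbitMultiplicity ℂ f m (k • χ) := by
  classical
  -- the exponent vectors of the degree-`k` monomials in `F₀, …, F_D`
  set E : Finset (Fin (D + 1) →₀ ℕ) := (Finset.univ : Finset (Fin (D + 1))).finsuppAntidiag k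
    with hE
  -- each such monomial is a highest-weight vector of weight `k • χ`
  have hmem : ∀ e ∈ E, ∏ i, F i ^ e i ∈ highestWeightSpace (orbitCoordRep f m) (k • χ) := by
    intro e he
    have hsum : ∑ i, e i = k := (Finset.mem_finsuppAntidiag.mp he).1
    have h := prod_pow_mem_highestWeightSpace_nsmul f m χ F hF e
    rwa [hsum] at h
  -- the monomials indexed by `E`, as vectors of the highest-weight space, are linearly independent
  have hli : LinearIndependent ℂ (fun e : ↥E =>
      (⟨∏ i, F i ^ (e : Fin (D + 1) →₀ ℕ) i, hmem e e.2⟩ :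
        ↥(highestWeightSpace (orbitCoordRep f m) (k • χ)))) := by
    refine LinearIndependent.of_comp (highestWeightSpace (orbitCoordRep f m) (k • χ)).subtype ?_
    exact (linearIndependent_prod_pow_of_algebraicIndependent F hind).comp
      (fun e : ↥E => (e : Fin (D + 1) →₀ ℕ)) Subtype.val_injective
  -- a weight pins the degree: the highest-weight space is finite-dimensional (`m ≠ 0`)
  haveI : FiniteDimensional ℂ ↥(highestWeightSpace (orbitCoordRep f m) (k • χ)) :=
    finiteDimensional_highestWeightSpace_orbitCoordRep_holds (k := ℂ) f hm (k • χ)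
  have hcard := hli.fintype_card_le_finrank
  rw [Fintype.card_coe, hE, card_finsuppAntidiag_fin_succ] at hcard
  exact hcard

end

end Summit.ValiantsHypothesis.ValiantsHypothesis.Theorems.ValuativeFlip.SemigroupFloorElementary
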